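import Mathlib
import Summits.CriticalPhenomena.CardyFormulaZ2.Theorems.CardySelfRefinementDefs
import Summits.CriticalPhenomena.CardyFormulaZ2.Theorems.CardySelfRefinementGradientComparabilityStubSlopeBoundsCornerPenaltySum
import HarnessLib

/-!
# Crux `GradientComparability` (stmt-CriticalPhenomena-10269), line `monotone-product-coordinates` —
# stub `stub_cornerLocalSlope` (LOC), penalty bound (A″_k), part 5: the penalty half of the signed
# domination `a ∂cP ≤ ∂ρP + B c ∂cP`

Route `CardySelfRefinement`, sub-problem `CriticalPhenomena/CardyFormulaZ2`; vocabulary from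
`CardySelfRefinementDefs` (`ax tb M Aloc window coinWindow edgeOf P Dρ Dc`); the exact corner dictionary
`Drho_eq_sum_half_pivotal_sub_defect` (`…StubCornerWindowsDefect`), the summed bulk penalty bound
`sum_defect_le_of_far` (part 4, `…StubSlopeBoundsCornerPenaltySum`) and Russo's formula for `∂cP`
(`stub_Dc_eq_sum_pivotal`).

## Mathematics

Write `N_T = Σ_{i ∈ T} M_k(ρ,c)(bundle of the selector i set-pivotal)` for a set `T` of selector coins
of the coin window `K`, and split the selectors into a set `S` of BULK bundles (all interior canonical
vertices `k t + j e_d`, `0 < j < k`, drawn at distance `≥ r ≥ 2η` from every quad side) and the rest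
(the boundary LAYER).  By the dictionary, `∂ρP = Σ_i (½ M(PIV_i) − 2^{-k} Σ_{J ⊆ [k]} M(DEF_{i,J}))`
with `DEF_{i,[k]} = PIV_i`, `DEF_{i,∅} = ∅`, `DEF_{i,J} ⊆ PIV_i`; so a layer selector contributes at
least `−(½ − 2^{-k}) M(PIV_i)`, and the bulk selectors contribute
`(½ − 2^{-k}) N_S − 2^{-k} Σ_{i ∈ S} Σ_{J ⊊ [k]} M(DEF_{i,J})`, whose penalty is bounded by part 4 with
its factor `c` and Russo's `∂cP = Σ_{e ∈ Wn} M(e pivotal)`.  Result (`Drho_add_mul_Dc_ge_of_far`,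
registered): for `0 < k`, `ρ ∈ [0,1]` (corner included), `0 ≤ c < 1`,

`(½ − 2^{-k} − c/(1−c)·2^{-k}·2(k−1)(2^k−1)) · N_S − (½ − 2^{-k}) · N_{K∖S} ≤ ∂ρP(ρ,c) + c·2^{-k}·2^{k+2}(2^k−1) · ∂cP(ρ,c)`.

For `c ≤ c₁(k)` the coefficient of `N_S` is `≥ (½ − 2^{-k})/2 > 0`: this is the penalty half of the
signed domination (SD) `a ∂cP ≤ ∂ρP + B c ∂cP` behind the local corner slope bound
(`cornerLocalSlope_of_signedDomination`); the other half is the corner transfer `∂cP ≤ C₂ N_S + layer`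
(B″_k) and the smallness of the layer count `N_{K∖S}` on the level band.
-/

noncomputable section

namespace Summit.CriticalPhenomena.CardyFormulaZ2.Theorems.CardySelfRefinement

open scoped Topology
open Filter Set MeasureTheory
open Literature.Probability.LatticeModels Literature.Probability.Percolation
open Literature.Probability.Percolation.QuadCrossing
open Summit.CriticalPhenomena.CardyFormulaZ2.Theses.CardySelfRefinement

/-! ## The penalty half of the signed domination: `∂ρP + B c ∂cP ≥ a(c) N_far − a₀ N_layer` -/

/-- **The penalty half of the signed domination (SD) behind `stub_cornerLocalSlope`** (registered
helper).  For `0 < k`, `0 < η`, `2η ≤ r`, `ρ ∈ [0,1]` (the corner `ρ = 1` included), `0 ≤ c < 1`, the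
coin Finset `K` of the window and ANY set `S` of selector coins of `K` whose bundles have all interior
canonical vertices drawn `r`-far from every quad side ("bulk bundles"; the consumer takes all of them):

`(½ − 2^{-k} − c/(1−c) · 2^{-k}·2(k−1)(2^k−1)) · N_S − (½ − 2^{-k}) · N_{K∖S} ≤ ∂ρP(ρ,c) + c · 2^{-k}·2^{k+2}(2^k−1) · ∂cP(ρ,c)`,

`N_T = Σ_{i ∈ T} M_k(ρ,c)(bundle of i set-pivotal)`.  Proof: the exact dictionary
`Drho_eq_sum_half_pivotal_sub_defect`, the bulk penalty bound `sum_defect_le_of_far` (the full pattern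
is the set-pivotal event, the empty one is empty), the crude bound `DEF ⊆ PIV` on the layer `K ∖ S`,
and Russo's formula `stub_Dc_eq_sum_pivotal` for `∂cP`.  What is left for (SD) is the corner transfer
`∂cP ≤ C₂ N + layer` (B″_k) and the smallness of the layer count `N_{K∖S}` on the level band. -/
theorem Drho_add_mul_Dc_ge_of_far : ∀ (k m : ℕ), 0 < k → ∀ (F : Fin m → Quad (Set.univ : Set ℂ)) (η r : ℝ), 0 < η → 2 * η ≤ r → ∀ (ρ c : ℝ), ρ ∈ Set.Icc (0 : ℝ) 1 → c ∈ Set.Ico (0 : ℝ) 1 → ∀ (K : Finset (Site 2 × Fin 2 × Fin 3)), (↑K : Set (Site 2 × Fin 2 × Fin 3)) = coinWindow k (window m F η) → ∀ (S : Finset (Site 2 × Fin 2 × Fin 3)), S ⊆ K.filter (fun i => i.2.2 = 2) → (∀ i ∈ S, ∀ j : ℕ, 0 < j → j < k → ∀ (a : Fin m) (b : Fin 4), ∀ p ∈ (F a).side b, r ≤ dist ((η : ℂ) * squareLatticeEmbedding.z (fun l => (k : ℤ) * i.1 l + if l = i.2.1 then (j : ℤ) else 0)) p) → (1 / 2 -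 (1 / 2) ^ k - c / (1 - c) * ((1 / 2) ^ k * (2 * ((k : ℝ) - 1) * (2 ^ k - 1)))) * ∑ i ∈ S, (M k ρ c).real {ω | ω ∪ edgeOf '' {vd : Site 2 × Fin 2 | ax k vd ∧ tb k vd = i.1 ∧ vd.2 = i.2.1} ∈ Aloc m F η ∧ ω \ edgeOf '' {vd : Site 2 × Fin 2 | ax k vd ∧ tb k vd = i.1 ∧ vd.2 = i.2.1} ∉ Aloc m F η} - (1 / 2 - (1 / 2) ^ k) * ∑ i ∈ K.filter (fun i => i.2.2 = 2) \ S, (M k ρ c).real {ω | ω ∪ edgeOf '' {vd : Site 2 × Fin 2 | ax k vd ∧ tb k vd = i.1 ∧ vd.2 = i.2.1} ∈ Aloc m F η ∧ ω \ edgeOf '' {vd : Site 2 × Fin 2 | ax k vd ∧ tb k vd = i.1 ∧ vd.2 = i.2.1} ∉ Aloc m F η} ≤ Dρ k m F η (ρ, c) + c * ((1 / 2) ^ k * (2 ^ (k + 2) * (2 ^ k - 1))) * Dc k m F η (ρ, c) := by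
  intro k m hk F η r hη hηr ρ c hρ hc K hK S hS hfar
  classical
  haveI := isProbabilityMeasure_M k ρ c
  have hc' : c ∈ Set.Icc (0 : ℝ) 1 := ⟨hc.1, hc.2.le⟩
  -- the non-axial window edges and Russo's formula for `∂cP`
  set Wn : Finset (Sym2 (Site 2)) := (window_finite m F hη.ne').toFinset.filter
    (fun e => ∃ (v : Site 2) (d : Fin 2), e = edgeOf (v, d) ∧ ¬ ax k (v, d)) with hWn_def
  have hWn : ∀ e, e ∈ Wn ↔ e ∈ window m F η ∧ ∃ (v : Site 2) (d : Fin 2), e = edgeOf (v, d) ∧ ¬ ax k (v, d) := by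
    intro e
    simp only [hWn_def, Finset.mem_filter, Set.Finite.mem_toFinset]
  have hDc := stub_Dc_eq_sum_pivotal k m F hη.ne' ρ hc' Wn hWn
  -- abbreviations
  set w : (Site 2 × Fin 2 × Fin 3) → ℕ → Site 2 :=
    fun i j l => (k : ℤ) * i.1 l + if l = i.2.1 then (j : ℤ) else 0 with hw
  set Bset : (Site 2 × Fin 2 × Fin 3) → Set (Sym2 (Site 2)) :=
    fun i => edgeOf '' {vd : Site 2 × Fin 2 | ax k vd ∧ tb k vd = i.1 ∧ vd.2 = i.2.1} with hBset
  set PIVs : (Site 2 × Fin 2 × Fin 3) → Set (BondConfig (Site 2)) :=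
    fun i => {ω | ω ∪ Bset i ∈ Aloc m F η ∧ ω \ Bset i ∉ Aloc m F η} with hPIVs
  set DEF : (Site 2 × Fin 2 × Fin 3) → Finset ℕ → Set (BondConfig (Site 2)) :=
    fun i J => {ω | ω \ Bset i ∪ ↑(J.image fun j : ℕ => edgeOf (w i j, i.2.1)) ∈ Aloc m F η} \
      {ω | ω \ Bset i ∈ Aloc m F η} with hDEF
  set piv : Sym2 (Site 2) → ℝ := fun e => (M k ρ c).real {ω | IsPivotal (Aloc m F η) e ω} with hpiv
  have hA := isUpperSet_Aloc m F η
  -- the full pattern is the set-pivotal event, every pattern defect is inside it, the empty one is empty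
  have htop : ∀ i : Site 2 × Fin 2 × Fin 3, i.2.2 = 2 → DEF i (Finset.range k) = PIVs i := by
    intro i _
    obtain ⟨hw₁, hw₂, -⟩ := bundle_param_canonical hk i.1 i.2.1
    have hB := coe_bundleFinset_eq_image k (w := w i) hw₁ hw₂ (B := (Finset.range k).image fun j => edgeOf (w i j, i.2.1)) rfl
    simp only [hDEF, hPIVs, hBset, ← hB, Set.sdiff_union_self]
    rfl
  have hsub : ∀ (i : Site 2 × Fin 2 × Fin 3) (J : Finset ℕ), J ⊆ Finset.range k → DEF i J ⊆ PIVs i := by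
    intro i J hJ ω hω
    obtain ⟨h1, h2⟩ := hω
    refine ⟨hA ?_ h1, h2⟩
    obtain ⟨hw₁, -, -⟩ := bundle_param_canonical hk i.1 i.2.1
    refine Set.union_subset (Set.sdiff_subset.trans Set.subset_union_left) (Set.Subset.trans ?_ Set.subset_union_right)
    rw [Finset.coe_image]
    rintro e ⟨j, hj, rfl⟩
    have hjk : j < k := Finset.mem_range.1 (hJ (Finset.mem_coe.1 hj))
    exact ⟨(w i j, i.2.1), ⟨(hw₁ j hjk).1, (hw₁ j hjk).2, rfl⟩, rfl⟩
  have hbot : ∀ i : Site 2 × Fin 2 × Fin 3, (M k ρ c).real (DEF i ∅) = 0 := by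
    intro i
    simp only [hDEF, Finset.image_empty, Finset.coe_empty, Set.union_empty, Set.sdiff_self, measureReal_empty]
  -- per-selector lower bounds
  have hsumJ : ∀ i : Site 2 × Fin 2 × Fin 3, i.2.2 = 2 →
      ∑ J ∈ (Finset.range k).powerset, (M k ρ c).real (DEF i J) =
        (M k ρ c).real (PIVs i) + ∑ J ∈ ((Finset.range k).powerset).erase (Finset.range k), (M k ρ c).real (DEF i J) := by
    intro i hi
    rw [← Finset.add_sum_erase _ _ (Finset.mem_powerset_self _), htop i hi]
  have hlayer : ∀ i : Site 2 × Fin 2 × Fin 3, i.2.2 = 2 →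
      ∑ J ∈ (Finset.range k).powerset, (M k ρ c).real (DEF i J) ≤ (2 ^ k - 1) * (M k ρ c).real (PIVs i) := by
    intro i _
    have h0 : (fun J : Finset ℕ => (M k ρ c).real (DEF i J)) ∅ = 0 := hbot i
    rw [← Finset.sum_erase ((Finset.range k).powerset) (f := fun J : Finset ℕ => (M k ρ c).real (DEF i J))
      (a := ∅) h0]
    have hcard : (((Finset.range k).powerset.erase ∅).card : ℝ) = 2 ^ k - 1 := by
      rw [Finset.card_erase_of_mem (Finset.empty_mem_powerset _), Finset.card_powerset, Finset.card_range,
        Nat.cast_sub Nat.one_le_two_pow]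
      push_cast
      ring
    calc ∑ J ∈ (Finset.range k).powerset.erase ∅, (M k ρ c).real (DEF i J)
        ≤ ∑ J ∈ (Finset.range k).powerset.erase ∅, (M k ρ c).real (PIVs i) :=
          Finset.sum_le_sum fun J hJ => measureReal_mono (hsub i J (Finset.mem_powerset.1 (Finset.mem_of_mem_erase hJ)))
      _ = (2 ^ k - 1) * (M k ρ c).real (PIVs i) := by rw [Finset.sum_const, nsmul_eq_mul, hcard]
  -- the dictionary, split into `S` and the layer (everything in one syntactic currency)
  have hS2 : ∀ i ∈ S, i.2.2 = 2 := fun i hi => (Finset.mem_filter.1 (hS hi)).2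
  have hDρ : Dρ k m F η (ρ, c) = ∑ i ∈ K.filter (fun i => i.2.2 = 2), (1 / 2 * (M k ρ c).real (PIVs i) -
      (1 / 2) ^ k * ∑ J ∈ (Finset.range k).powerset, (M k ρ c).real (DEF i J)) :=
    Drho_eq_sum_half_pivotal_sub_defect k m hk F hη.ne' hρ c K hK
  have hsplit := Finset.sum_sdiff hS (f := fun i => (1 / 2 * (M k ρ c).real (PIVs i) -
    (1 / 2) ^ k * ∑ J ∈ (Finset.range k).powerset, (M k ρ c).real (DEF i J)))
  have hbulk : ∑ i ∈ S, ∑ J ∈ ((Finset.range k).powerset).erase (Finset.range k), (M k ρ c).real (DEF i J) ≤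
      c * (2 * ((k : ℝ) - 1) * (2 ^ k - 1) / (1 - c) * ∑ i ∈ S, (M k ρ c).real (PIVs i) +
        2 ^ (k + 2) * (2 ^ k - 1) * ∑ e ∈ Wn, piv e) :=
    sum_defect_le_of_far k m hk F η r hη hηr ρ c hc Wn hWn S hS2 hfar
  have hDc' : Dc k m F η (ρ, c) = ∑ e ∈ Wn, piv e := hDc
  have hp : (0 : ℝ) ≤ (1 / 2) ^ k := by positivity
  have h12 : (1 / 2 : ℝ) ^ k * 2 ^ k = 1 := by rw [← mul_pow]; norm_num
  have hSsum : ∑ i ∈ S, (1 / 2 * (M k ρ c).real (PIVs i) - (1 / 2) ^ k * ∑ J ∈ (Finset.range k).powerset,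
      (M k ρ c).real (DEF i J)) = (1 / 2 - (1 / 2) ^ k) * ∑ i ∈ S, (M k ρ c).real (PIVs i) -
        (1 / 2) ^ k * ∑ i ∈ S, ∑ J ∈ ((Finset.range k).powerset).erase (Finset.range k), (M k ρ c).real (DEF i J) := by
    rw [Finset.sum_congr rfl fun i hi => by rw [hsumJ i (hS2 i hi)], Finset.mul_sum, Finset.mul_sum, ← Finset.sum_sub_distrib]
    refine Finset.sum_congr rfl fun i _ => ?_
    ring
  have hLsum : -((1 / 2 - (1 / 2) ^ k) * ∑ i ∈ K.filter (fun i => i.2.2 = 2) \ S, (M k ρ c).real (PIVs i)) ≤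
      ∑ i ∈ K.filter (fun i => i.2.2 = 2) \ S, (1 / 2 * (M k ρ c).real (PIVs i) -
        (1 / 2) ^ k * ∑ J ∈ (Finset.range k).powerset, (M k ρ c).real (DEF i J)) := by
    rw [Finset.mul_sum, ← Finset.sum_neg_distrib]
    refine Finset.sum_le_sum fun i hi => ?_
    have hi2 : i.2.2 = 2 := (Finset.mem_filter.1 (Finset.mem_sdiff.1 hi).1).2
    have h := mul_le_mul_of_nonneg_left (hlayer i hi2) hp
    have e : (1 / 2 : ℝ) ^ k * ((2 ^ k - 1) * (M k ρ c).real (PIVs i)) =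
        (M k ρ c).real (PIVs i) - (1 / 2) ^ k * (M k ρ c).real (PIVs i) := by
      linear_combination (M k ρ c).real (PIVs i) * h12
    linarith
  have hb2 := mul_le_mul_of_nonneg_left hbulk hp
  -- assemble over opaque reals
  have hgoal : ∀ (NS NL DS Pv LT : ℝ),
      DS ≤ c * (2 * ((k : ℝ) - 1) * (2 ^ k - 1) / (1 - c) * NS + 2 ^ (k + 2) * (2 ^ k - 1) * Pv) →
      -((1 / 2 - (1 / 2) ^ k) * NL) ≤ LT →
      (1 / 2 - (1 / 2) ^ k - c / (1 - c) * ((1 / 2) ^ k * (2 * ((k : ℝ) - 1) * (2 ^ k - 1)))) * NS -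
          (1 / 2 - (1 / 2) ^ k) * NL ≤
        LT + ((1 / 2 - (1 / 2) ^ k) * NS - (1 / 2) ^ k * DS) + c * ((1 / 2) ^ k * (2 ^ (k + 2) * (2 ^ k - 1))) * Pv := by
    intro NS NL DS Pv LT h1 h2
    have h1' := mul_le_mul_of_nonneg_left h1 hp
    have e : (1 / 2 : ℝ) ^ k * (c * (2 * ((k : ℝ) - 1) * (2 ^ k - 1) / (1 - c) * NS + 2 ^ (k + 2) * (2 ^ k - 1) * Pv)) =
        c / (1 - c) * ((1 / 2) ^ k * (2 * ((k : ℝ) - 1) * (2 ^ k - 1))) * NS +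
          c * ((1 / 2) ^ k * (2 ^ (k + 2) * (2 ^ k - 1))) * Pv := by ring
    linarith
  rw [hDρ, ← hsplit, hSsum, hDc']
  exact hgoal _ _ _ _ _ hbulk hLsum

end Summit.CriticalPhenomena.CardyFormulaZ2.Theorems.CardySelfRefinement

end
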